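/- Fleet lead `ym-wcr-19456-p1` (seat g2), route `WeakCouplingRates`, crux `ColdBoxTwoPointFloorW` (stmt-QuantumFields-19608). -/
import Summits.QuantumFields.YangMills.Theorems.WeakCouplingRatesDirichletVsFree
import Summits.QuantumFields.YangMills.Theorems.WeakCouplingRatesColdBoxDirichletWick
import Summits.QuantumFields.YangMills.Theorems.WeakCouplingRatesColdBoxTwoPointFloorStubBoxGaussianWick

/-!
# Crux `ColdBoxTwoPointFloorW` (stmt-QuantumFields-19608), registered stub `stub_boxGaussianDomination` (skeleton v5):
# reduction of the registered RELATIVE form to the ABSOLUTE Dirichlet comparison (the output of the one-scale expansion)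

The registered stub compares `β²·boxPlaqCov` with the FREE surrogate `¾·boxCircSqCov = (3/2)Π²` (`Π = boxMaxwellPlaqCov`,
Wick `stub_boxGaussianWick`) within the RELATIVE band `½Π²`.  The one-scale expansion of the cold-wall box (assembly files of this
line) naturally yields the ABSOLUTE comparison with the box's OWN (temporal-gauge Dirichlet) linearisation,
`|β²·boxPlaqCov(β,H,T) − ¾·boxDirCircSqCov H T| ≤ β^{−κ}` for all `T ≤ H = ⌈β^θ⌉`, `κ > 8θ`, `θ ≤ θ₀`
(the statement `stub_boxDirichletDominationAbs` of the lead's v7 proposal, evidence #4 on the item).  This file proves, once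
and for all, that the absolute Dirichlet form IMPLIES the registered stub (`stub_boxGaussianDomination_of_abs`), using only tree
theorems on the Gaussian side:
* `boxDirCircSqCov_eq_two_mul_sq` (Dirichlet Wick, `¾·boxDirCircSqCov = (3/2)Π_D²`), `stub_boxGaussianWick` (free Wick);
* `exists_boxDirichletPlaqCov_sub_bound`, `exists_boxMaxwellPlaqCov_sub_bound` (`|Π_D − C(T)|, |Π − C(T)| ≤ K/H⁴`, `H ≥ 32`,
  `T ≤ H/8`; seat ym-wcr-19608-p2) and `exists_curvaturePlaquetteCorr_asymp` (`|C(T) − T⁻⁴/π²| ≤ K/T⁵`).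
With `H/T ≥ β^{θ−A}/2 → ∞` both kernels are within `C(T)/40` of `C(T) > 0`, and `β^{−κ} ≤ C(T)²/20` eventually (`κ > 8θ > 8A`,
`C(T) ≥ 1/(2π²T⁴)`, `T ≤ 2β^A`); the scalar endgame `scalar_relative_of_abs` then gives the `½Π²` band.
Everything proved; no definition; no sorry; standard axioms.  NOT a claim about the mass gap.
-/

set_option autoImplicit false

noncomputable section

open Real
open Literature.MathematicalPhysics.QuantumLattice
open Literature.MathematicalPhysics.QuantumFieldTheory

namespace Summit.QuantumFields.YangMills.Theorems.WeakCouplingRates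

/-- **Scalar endgame.**  If `a, b` are within `C/40` of `C ≥ 0` and `|e| ≤ C²/20`, then
`|(¾·2b² + e) − ¾·2a²| ≤ ½a²` (`(3/2)|b² − a²| ≤ (3/2)(C/20)(82C/40) < 0.16C²`, `½a² ≥ ½(39/40)²C² > 0.47C²`). -/
theorem scalar_relative_of_abs {a b C e : ℝ} (hC : 0 ≤ C) (ha : |a - C| ≤ C / 40) (hb : |b - C| ≤ C / 40)
    (he : |e| ≤ C ^ 2 / 20) : |3 / 4 * (2 * b ^ 2) + e - 3 / 4 * (2 * a ^ 2)| ≤ 1 / 2 * a ^ 2 := by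
  rw [abs_le] at ha hb he ⊢
  obtain ⟨ha1, ha2⟩ := ha
  obtain ⟨hb1, hb2⟩ := hb
  obtain ⟨he1, he2⟩ := he
  have ha0 : 39 / 40 * C ≤ a := by linarith
  have ha3 : a ≤ 41 / 40 * C := by linarith
  have hb0 : 39 / 40 * C ≤ b := by linarith
  have hb3 : b ≤ 41 / 40 * C := by linarith
  have hapos : 0 ≤ a := le_trans (by positivity) ha0
  have hbpos : 0 ≤ b := le_trans (by positivity) hb0
  have hsq1 : b ^ 2 - a ^ 2 ≤ 41 / 400 * C ^ 2 := by nlinarith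
  have hsq2 : a ^ 2 - b ^ 2 ≤ 41 / 400 * C ^ 2 := by nlinarith
  have ha2low : (39 / 40) ^ 2 * C ^ 2 ≤ a ^ 2 := by nlinarith
  constructor <;> nlinarith

/-- Eventually `β^{-κ} · (2β^A)^8 ≤ K` when `8A < κ` (`K > 0`). -/
theorem rpow_neg_mul_pow_le_eventually {A κ K : ℝ} (hκ : 8 * A < κ) (hK : 0 < K) :
    ∃ β₀ : ℝ, 1 ≤ β₀ ∧ ∀ β : ℝ, β₀ ≤ β → β ^ (-κ) * (2 * β ^ A) ^ (8 : ℕ) ≤ K := by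
  have hpos : 0 < κ - 8 * A := by linarith
  -- choose β₀ with β₀^{κ - 8A} ≥ 256 / K
  refine ⟨max 1 ((256 / K) ^ (1 / (κ - 8 * A))), le_max_left _ _, fun β hβ => ?_⟩
  have hβ1 : 1 ≤ β := (le_max_left _ _).trans hβ
  have hβ0 : 0 < β := by linarith
  have hroot : 256 / K ≤ β ^ (κ - 8 * A) :=
    le_rpow_of_root_le (by positivity) hpos ((le_max_right _ _).trans hβ)
  have e : β ^ (-κ) * (2 * β ^ A) ^ (8 : ℕ) = 256 / β ^ (κ - 8 * A) := by
    rw [mul_pow, ← Real.rpow_natCast (β ^ A) 8, ← Real.rpow_mul hβ0.le, Real.rpow_sub hβ0, Real.rpow_neg hβ0.le]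
    push_cast
    have h8 : β ^ (A * 8) = β ^ (8 * A) := by rw [mul_comm]
    rw [h8]
    have hne : β ^ κ ≠ 0 := (Real.rpow_pos_of_pos hβ0 κ).ne'
    field_simp
    ring
  rw [e, div_le_iff₀ (Real.rpow_pos_of_pos hβ0 _)]
  have := (div_le_iff₀ hK).1 (show 256 / K ≤ β ^ (κ - 8 * A) from hroot)
  linarith [mul_comm K (β ^ (κ - 8 * A))]

/-- **The absolute Dirichlet comparison implies the registered stub `stub_boxGaussianDomination`.**  Hypothesis = the ABSOLUTE
one-scale statement (v7 `stub_boxDirichletDominationAbs`): `∃ θ₀ > 0, ∀ 0 < θ ≤ θ₀, ∃ κ > 8θ, ∃ β₀, ∀ β ≥ β₀, ∀ T ≤ ⌈β^θ⌉,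
|β²·boxPlaqCov(β,⌈β^θ⌉,T) − ¾·boxDirCircSqCov ⌈β^θ⌉ T| ≤ β^{−κ}`.  Conclusion = the registered signature verbatim (same `θ₀`). -/
theorem stub_boxGaussianDomination_of_abs
    (habs : ∃ θ₀ : ℝ, 0 < θ₀ ∧ ∀ θ : ℝ, 0 < θ → θ ≤ θ₀ → ∃ κ : ℝ, 8 * θ < κ ∧ ∃ β₀ : ℝ, ∀ β : ℝ, β₀ ≤ β →
      ∀ T : ℕ, T ≤ ⌈β ^ θ⌉₊ →
        |β ^ 2 * boxPlaqCov (fundamentalRep (Fin 2)) β ⌈β ^ θ⌉₊ T - 3 / 4 * boxDirCircSqCov ⌈β ^ θ⌉₊ T| ≤ β ^ (-κ)) :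
    ∃ θ₀ : ℝ, 0 < θ₀ ∧ ∀ A θ : ℝ, 0 < A → A < θ → θ ≤ θ₀ → ∃ β₀ : ℝ, ∀ β : ℝ, β₀ ≤ β →
      |β ^ 2 * boxPlaqCov (Literature.MathematicalPhysics.QuantumLattice.fundamentalRep (Fin 2)) β ⌈β ^ θ⌉₊ ⌈β ^ A⌉₊ -
          3 / 4 * boxCircSqCov ⌈β ^ θ⌉₊ ⌈β ^ A⌉₊| ≤ 1 / 2 * boxMaxwellPlaqCov ⌈β ^ θ⌉₊ ⌈β ^ A⌉₊ ^ 2 := by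
  obtain ⟨θ₀, hθ₀, habs⟩ := habs
  refine ⟨θ₀, hθ₀, fun A θ hA hAθ hθle => ?_⟩
  have hθ : 0 < θ := hA.trans hAθ
  obtain ⟨κ, hκ, β₁, h₁⟩ := habs θ hθ hθle
  obtain ⟨K₁, hK10, hE1⟩ := exists_boxMaxwellPlaqCov_sub_bound
  obtain ⟨K₂, hK20, hE2⟩ := exists_boxDirichletPlaqCov_sub_bound
  obtain ⟨K_C, hKC0, hC⟩ := exists_curvaturePlaquetteCorr_asymp
  have hθA : 0 < θ - A := by linarith
  -- constants: kernel errors ≤ C/40, asymptotic error ≤ C₀/2, absolute error ≤ C²/20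
  set M : ℝ := 1 + 80 * π ^ 2 * (K₁ + K₂) with hM
  have hM0 : 0 ≤ 80 * π ^ 2 * (K₁ + K₂) := by positivity
  have hM1 : 1 ≤ M := by linarith
  set L : ℝ := 2 * π ^ 2 * K_C + 1 with hL
  have hL0 : 0 ≤ 2 * π ^ 2 * K_C := by positivity
  have hL1 : 1 ≤ L := by linarith
  obtain ⟨β₄, hβ₄1, h₄⟩ := rpow_neg_mul_pow_le_eventually (A := A) (κ := κ) (by linarith)
    (by positivity : (0 : ℝ) < 1 / (4 * π ^ 4) / 20)
  set β₀ : ℝ := max (max (max 1 ((32 : ℝ) ^ (1 / θ))) (max ((16 * M) ^ (1 / (θ - A))) (L ^ (1 / A)))) (max β₁ β₄) with hβ₀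
  refine ⟨β₀, fun β hβ => ?_⟩
  have hβa : max (max 1 ((32 : ℝ) ^ (1 / θ))) (max ((16 * M) ^ (1 / (θ - A))) (L ^ (1 / A))) ≤ β := (le_max_left _ _).trans hβ
  have hb₁ : β₁ ≤ β := le_trans (le_trans (le_max_left _ _) (le_max_right _ _)) hβ
  have hb₄ : β₄ ≤ β := le_trans (le_trans (le_max_right _ _) (le_max_right _ _)) hβ
  have hβ1 : 1 ≤ β := le_trans (le_trans (le_max_left _ _) (le_max_left _ _)) hβa
  have hβpos : 0 < β := by linarith
  have hθpow : (32 : ℝ) ≤ β ^ θ :=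
    le_rpow_of_root_le (by norm_num) hθ (le_trans (le_trans (le_max_right _ _) (le_max_left _ _)) hβa)
  have hdiff : 16 * M ≤ β ^ (θ - A) :=
    le_rpow_of_root_le (by positivity) hθA (le_trans (le_trans (le_max_left _ _) (le_max_right _ _)) hβa)
  have hApow : L ≤ β ^ A :=
    le_rpow_of_root_le (by positivity) hA (le_trans (le_trans (le_max_right _ _) (le_max_right _ _)) hβa)
  have hA1 : 1 ≤ β ^ A := hL1.trans hApow
  have hsplit : β ^ θ = β ^ (θ - A) * β ^ A := by
    rw [← Real.rpow_add hβpos]; ring_nf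
  set T : ℕ := ⌈β ^ A⌉₊ with hT
  set H : ℕ := ⌈β ^ θ⌉₊ with hH
  have hT_ge : β ^ A ≤ (T : ℝ) := Nat.le_ceil _
  have hT_lt : (T : ℝ) < β ^ A + 1 := Nat.ceil_lt_add_one (by positivity)
  have hT_le : (T : ℝ) ≤ 2 * β ^ A := by linarith
  have hH_ge : β ^ θ ≤ (H : ℝ) := Nat.le_ceil _
  have hT1 : 1 ≤ T := by
    have : (1 : ℝ) ≤ T := hA1.trans hT_ge
    exact_mod_cast this
  have hT0 : (0 : ℝ) < T := by exact_mod_cast hT1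
  have hH32 : (32 : ℝ) ≤ H := hθpow.trans hH_ge
  have hH0 : (0 : ℝ) < H := by linarith
  have hTH_nat : T ≤ H := Nat.ceil_mono (Real.rpow_le_rpow_of_exponent_le hβ1 hAθ.le)
  have hHT : M * (T : ℝ) ≤ (H : ℝ) / 8 := by
    have h1 : M * (T : ℝ) ≤ M * (2 * β ^ A) := mul_le_mul_of_nonneg_left hT_le (by linarith)
    have h2 : 16 * M * β ^ A ≤ β ^ (θ - A) * β ^ A := mul_le_mul_of_nonneg_right hdiff (by linarith)
    rw [← hsplit] at h2
    linarith
  have hTH : (T : ℝ) ≤ (H : ℝ) / 8 := by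
    have : (T : ℝ) ≤ M * T := le_mul_of_one_le_left hT0.le hM1
    linarith
  -- the curvature number and its lower bound
  set C := @Literature.MathematicalPhysics.QuantumFieldTheory.curvaturePlaquetteCorr 4 (by norm_num) (T : ℤ) with hCdef
  have hasy := hC T hT1
  have hCT : K_C / (T : ℝ) ^ 5 ≤ (1 / π ^ 2 / (T : ℝ) ^ 4) / 2 := by
    have hLT : L ≤ (T : ℝ) := hApow.trans hT_ge
    have hKT : 2 * π ^ 2 * K_C ≤ (T : ℝ) := by linarith
    have e : (1 / π ^ 2 / (T : ℝ) ^ 4) / 2 = 1 / (2 * π ^ 2) / (T : ℝ) ^ 4 := by field_simp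
    rw [e, div_le_div_iff₀ (by positivity) (by positivity)]
    calc K_C * (T : ℝ) ^ 4 = (2 * π ^ 2 * K_C) * (T : ℝ) ^ 4 * (1 / (2 * π ^ 2)) := by field_simp
      _ ≤ (T : ℝ) * (T : ℝ) ^ 4 * (1 / (2 * π ^ 2)) := by gcongr
      _ = 1 / (2 * π ^ 2) * (T : ℝ) ^ 5 := by ring
  have hClow : (1 / π ^ 2 / (T : ℝ) ^ 4) / 2 ≤ C := by
    rw [abs_le] at hasy; linarith [hasy.1]
  have hC0 : 0 ≤ C := le_trans (by positivity) hClow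
  -- the two kernel errors are `≤ C/40`
  have herrK : ∀ {K : ℝ}, 0 ≤ K → K ≤ K₁ + K₂ → K / (H : ℝ) ^ 4 ≤ C / 40 := by
    intro K hK0 hKle
    have hMT : M * (T : ℝ) ≤ H := by linarith
    have hMT4 : (M * (T : ℝ)) ^ 4 ≤ (H : ℝ) ^ 4 := pow_le_pow_left₀ (by positivity) hMT 4
    have hM4 : 80 * π ^ 2 * K ≤ M ^ 4 := by
      have : M ≤ M ^ 4 := by
        calc M = M ^ 1 := (pow_one M).symm
          _ ≤ M ^ 4 := pow_le_pow_right₀ hM1 (by norm_num)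
      nlinarith [Real.pi_pos]
    have hstep : K / (H : ℝ) ^ 4 ≤ 1 / (80 * π ^ 2) / (T : ℝ) ^ 4 := by
      rw [div_le_div_iff₀ (by positivity) (by positivity)]
      calc K * (T : ℝ) ^ 4 = (80 * π ^ 2 * K) * (T : ℝ) ^ 4 * (1 / (80 * π ^ 2)) := by field_simp
        _ ≤ M ^ 4 * (T : ℝ) ^ 4 * (1 / (80 * π ^ 2)) := by gcongr
        _ = 1 / (80 * π ^ 2) * (M * (T : ℝ)) ^ 4 := by ring
        _ ≤ 1 / (80 * π ^ 2) * (H : ℝ) ^ 4 := mul_le_mul_of_nonneg_left hMT4 (by positivity)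
    have e : 1 / (80 * π ^ 2) / (T : ℝ) ^ 4 = ((1 / π ^ 2 / (T : ℝ) ^ 4) / 2) / 40 := by field_simp; ring
    rw [e] at hstep
    exact hstep.trans (by linarith)
  have h1 : |boxMaxwellPlaqCov H T - C| ≤ C / 40 := (hE1 H hH32 T hTH).trans (herrK hK10 (by linarith))
  have h2 : |boxDirichletPlaqCov H T - C| ≤ C / 40 := (hE2 H hH32 T hTH).trans (herrK hK20 (by linarith))
  -- the absolute error is `≤ C²/20`
  have hC2 : 1 / (4 * π ^ 4) / (2 * β ^ A) ^ (8 : ℕ) ≤ C ^ 2 := by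
    have hsq := pow_le_pow_left₀ (by positivity) hClow 2
    have hT8 : (T : ℝ) ^ 8 ≤ (2 * β ^ A) ^ (8 : ℕ) := pow_le_pow_left₀ hT0.le hT_le 8
    calc 1 / (4 * π ^ 4) / (2 * β ^ A) ^ (8 : ℕ) ≤ 1 / (4 * π ^ 4) / (T : ℝ) ^ 8 :=
          div_le_div_of_nonneg_left (by positivity) (by positivity) hT8
      _ = ((1 / π ^ 2 / (T : ℝ) ^ 4) / 2) ^ 2 := by field_simp; ring
      _ ≤ C ^ 2 := hsq
  have hsmall : β ^ (-κ) ≤ C ^ 2 / 20 := by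
    have e4 := h₄ β hb₄
    have hden : (0 : ℝ) < (2 * β ^ A) ^ (8 : ℕ) := by positivity
    have h3 : β ^ (-κ) ≤ 1 / (4 * π ^ 4) / 20 / (2 * β ^ A) ^ (8 : ℕ) := by
      rw [le_div_iff₀ hden]; exact e4
    calc β ^ (-κ) ≤ 1 / (4 * π ^ 4) / 20 / (2 * β ^ A) ^ (8 : ℕ) := h3
      _ = (1 / (4 * π ^ 4) / (2 * β ^ A) ^ (8 : ℕ)) / 20 := by ring
      _ ≤ C ^ 2 / 20 := by linarith [hC2]
  have habsT := (h₁ β hb₁ T hTH_nat).trans hsmall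
  -- Wick on both sides and the scalar endgame
  rw [stub_boxGaussianWick]
  set e : ℝ := β ^ 2 * boxPlaqCov (fundamentalRep (Fin 2)) β H T - 3 / 4 * boxDirCircSqCov H T with he
  have hcov : β ^ 2 * boxPlaqCov (fundamentalRep (Fin 2)) β H T = 3 / 4 * (2 * boxDirichletPlaqCov H T ^ 2) + e := by
    rw [he, boxDirCircSqCov_eq_two_mul_sq]; ring
  rw [hcov]
  exact scalar_relative_of_abs hC0 h1 h2 habsT

end Summit.QuantumFields.YangMills.Theorems.WeakCouplingRates

end
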